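import Summits.RiemannHypothesis.RiemannHypothesis.Theorems.PfPersistenceDialLemma
import HarnessLib

/-!
# PF-persistence — FIXED-TEST restricted Weil criteria meet negative dials (exact pencil form)

mechanism/rigidity campaign; **no RH claims**.  Cell `pub-rhpf`, CAND SEAT 6 (gen 2), leaf G1.10 of
the CASE-DAG ("restricted Weil criteria ∀a: finitely many w-INDEPENDENT tests per window"), (U) column.

A FIXED-TEST criterion at a window is a conjunction `∀ i ∈ S, 0 ≤ tᵢᵀ M tᵢ` over finitely many
OBJECT-INDEPENDENT test vectors `tᵢ` (they may depend on the window `(a, N)`, not on the weight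
table).  It is a NECESSARY condition for window-positivity (`fixedTests_of_windowPositive`), its
acceptance set is convex (so the midpoint lemma of `PfPersistenceMidpointLemma` does not apply), and
along the one-prime pencil `M = Q − c·B` (`Q = evenBlock w win`, `B = primePattern p win`,
realised by the dial `K = 1 + c/(2 w p)`, `evenBlock_dial_coeff`) its acceptance set is the interval
`[−min_{bᵢ<0} qᵢ/|bᵢ|, min_{bᵢ>0} qᵢ/bᵢ] ∋ 0` (`qᵢ = tᵢᵀQtᵢ ≥ 0`, `bᵢ = tᵢᵀBtᵢ`).

**PROVED here (EXACT form of the dial lemma for this class — no stability modulus, no factor 2).**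
`fixedTests_sub_smul_meets_negative` / `fixedTests_meets_negative` (up side) and
`fixedTests_add_smul_meets_negative` / `fixedTests_meets_negative_down` (down side): if SOME vector `u`
has pattern value `β(u) = uᵀBu > 0` and beats every positively-patterned test in the pencil ratio,
`R(u)/β(u) < qᵢ/bᵢ` for all `i` with `bᵢ > 0` (cross-multiplied: `R(u)·bᵢ < qᵢ·β(u)`), then some
dial block passes every test and is NOT window-positive.  CONTRAPOSITIVE (the content): a fixed-test
criterion accepting `Q` that is sound against the up-dials at the window must contain a test `tᵢ`
with `bᵢ > 0` and `qᵢ/bᵢ ≤ R(u)/β(u)` for EVERY `u` with `β(u) > 0`, i.e. `qᵢ/bᵢ = c⁺(win) :=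
inf_{β(u)>0} R(u)/β(u)`, the exact coefficient beyond which the pencil leaves the positive cone — the
test IS an extremal vector of the pencil `(Q_ζ(win), B_p(win))`; likewise a test with `bⱼ < 0`
attaining `c⁻(win)` on the down side.  Since `c⁺(win) ≤ ε₁(win)/β(u₁(win))` (take `u = u₁`), whose
`lg` is `−27.9` at `a = 1`, `p = 2` and `≈ −130` at `a = 1.65` [DATA, FK-DIAL-CERT / atlas], an
object-independent test family is sound at a window only if it reproduces `ζ`'s extremal pencil
vectors there to that precision (A15-type `ζ`-encoding); every other family accepts a negative dial of
size in `(c⁺, min qᵢ/bᵢ)`.  INSTANCE [DATA + ELEMENTARY]: the served prolate guess `k̂_a` has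
`R(k̂_a)/ε₁ ∈ [1.07, 1.51]` on the 50 `ζ` windows carrying it (`rayleigh_guess_over_eps1_even`) and
`b(k̂_a) > 0`, so the single test `[R(k̂_a) ≥ 0]` accepts the up-dials of size between `1×` and
`≈ 1.07–1.51×` the threshold (unsound, sizes far below every served dial) and, being affine with
`b > 0`, accepts EVERY down-dial / prime-deletion object at every window (unsound on all served
down objects) while rejecting every served up-dial.

All statements are finite-dimensional algebra over the tree's vocabulary (`Window`, `Weights`,
`evenBlock`, `primePattern`, `dial`, `WindowPositive`, `rayleigh_sub_smul`,
`not_windowPositive_sub_smul`, `evenBlock_dial_coeff`); no analytic input.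
-/

set_option linter.dupNamespace false

noncomputable section

open Matrix

namespace Summit.RiemannHypothesis.RiemannHypothesis.Theorems.PfPersistence

/-- PROVED (complete side): a fixed-test criterion never rejects a window-positive block. [folklore] -/
theorem fixedTests_of_windowPositive {ι : Type*} {n : ℕ} (S : Finset ι) (t : ι → Fin n → ℝ)
    {M : Matrix (Fin n) (Fin n) ℝ} (hM : WindowPositive M) : (∀ i ∈ S, 0 ≤ t i ⬝ᵥ (M *ᵥ t i)) :=
  fun i _ => hM (t i)

/-- **PROVED (fixed tests meet the pencil's negatives — abstract, up side).**  `Q`, `B` any real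
matrices; if the tests accept `Q` and some `u` with `uᵀBu > 0` satisfies `R(u)·bᵢ < qᵢ·β(u)` for every
test with `bᵢ > 0`, then for some `c ≥ 0` the block `Q − c·B` passes every test and is not
window-positive.  (`c = min_{bᵢ>0} qᵢ/bᵢ` if some `bᵢ > 0`, else any `c > max(0, R(u)/β(u))`.) [folklore] -/
theorem fixedTests_sub_smul_meets_negative {ι : Type*} {n : ℕ} (S : Finset ι) (t : ι → Fin n → ℝ)
    (Q B : Matrix (Fin n) (Fin n) ℝ) (hacc : (∀ i ∈ S, 0 ≤ t i ⬝ᵥ (Q *ᵥ t i)))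
    (u : Fin n → ℝ) (hβ : 0 < u ⬝ᵥ (B *ᵥ u))
    (hgap : ∀ i ∈ S, 0 < t i ⬝ᵥ (B *ᵥ t i) →
      (u ⬝ᵥ (Q *ᵥ u)) * (t i ⬝ᵥ (B *ᵥ t i)) < (t i ⬝ᵥ (Q *ᵥ t i)) * (u ⬝ᵥ (B *ᵥ u))) :
    ∃ c : ℝ, 0 ≤ c ∧ (∀ i ∈ S, 0 ≤ t i ⬝ᵥ ((Q - c • B) *ᵥ t i)) ∧ ¬ WindowPositive (Q - c • B) := by
  classical
  by_cases hne : (S.filter (fun i => 0 < t i ⬝ᵥ (B *ᵥ t i))).Nonempty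
  · obtain ⟨j, hjF, hjmin⟩ := (S.filter (fun i => 0 < t i ⬝ᵥ (B *ᵥ t i))).exists_min_image
      (fun i => (t i ⬝ᵥ (Q *ᵥ t i)) / (t i ⬝ᵥ (B *ᵥ t i))) hne
    have hjS : j ∈ S := (Finset.mem_filter.mp hjF).1
    have hbj : 0 < t j ⬝ᵥ (B *ᵥ t j) := (Finset.mem_filter.mp hjF).2
    have hqj : 0 ≤ t j ⬝ᵥ (Q *ᵥ t j) := hacc j hjS
    have hc0 : 0 ≤ (t j ⬝ᵥ (Q *ᵥ t j)) / (t j ⬝ᵥ (B *ᵥ t j)) := div_nonneg hqj hbj.le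
    refine ⟨(t j ⬝ᵥ (Q *ᵥ t j)) / (t j ⬝ᵥ (B *ᵥ t j)), hc0, ?_, ?_⟩
    · intro i hi
      rw [rayleigh_sub_smul]
      by_cases hbi : 0 < t i ⬝ᵥ (B *ᵥ t i)
      · have hmin := hjmin i (Finset.mem_filter.mpr ⟨hi, hbi⟩)
        have hle : (t j ⬝ᵥ (Q *ᵥ t j)) / (t j ⬝ᵥ (B *ᵥ t j)) * (t i ⬝ᵥ (B *ᵥ t i)) ≤
            t i ⬝ᵥ (Q *ᵥ t i) := (le_div_iff₀ hbi).mp hmin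
        linarith
      · have hbi' : t i ⬝ᵥ (B *ᵥ t i) ≤ 0 := not_lt.mp hbi
        nlinarith [hacc i hi, hc0, hbi']
    · apply not_windowPositive_sub_smul u
      rw [div_mul_eq_mul_div, lt_div_iff₀ hbj]
      exact hgap j hjS hbj
  · have hc0 : 0 ≤ max 0 ((u ⬝ᵥ (Q *ᵥ u)) / (u ⬝ᵥ (B *ᵥ u))) := le_max_left _ _
    refine ⟨max 0 ((u ⬝ᵥ (Q *ᵥ u)) / (u ⬝ᵥ (B *ᵥ u))) + 1, by linarith, ?_, ?_⟩
    · intro i hi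
      rw [rayleigh_sub_smul]
      have hbi : t i ⬝ᵥ (B *ᵥ t i) ≤ 0 :=
        not_lt.mp (fun h => hne ⟨i, Finset.mem_filter.mpr ⟨hi, h⟩⟩)
      nlinarith [hacc i hi, hc0, hbi]
    · apply not_windowPositive_sub_smul u
      rw [← div_lt_iff₀ hβ]
      have := le_max_right 0 ((u ⬝ᵥ (Q *ᵥ u)) / (u ⬝ᵥ (B *ᵥ u)))
      linarith

/-- **PROVED (abstract, down side).**  Mirror image along `Q + c·B`: a vector `u` with `uᵀBu < 0`
beating every negatively-patterned test (`qᵢ·β(u) < R(u)·bᵢ` for `bᵢ < 0`, i.e. `R(u)/|β(u)| <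
qᵢ/|bᵢ|`) yields a dial block passing every test and not window-positive. [folklore] -/
theorem fixedTests_add_smul_meets_negative {ι : Type*} {n : ℕ} (S : Finset ι) (t : ι → Fin n → ℝ)
    (Q B : Matrix (Fin n) (Fin n) ℝ) (hacc : (∀ i ∈ S, 0 ≤ t i ⬝ᵥ (Q *ᵥ t i)))
    (u : Fin n → ℝ) (hβ : u ⬝ᵥ (B *ᵥ u) < 0)
    (hgap : ∀ i ∈ S, t i ⬝ᵥ (B *ᵥ t i) < 0 →
      (t i ⬝ᵥ (Q *ᵥ t i)) * (u ⬝ᵥ (B *ᵥ u)) < (u ⬝ᵥ (Q *ᵥ u)) * (t i ⬝ᵥ (B *ᵥ t i))) :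
    ∃ c : ℝ, 0 ≤ c ∧ (∀ i ∈ S, 0 ≤ t i ⬝ᵥ ((Q + c • B) *ᵥ t i)) ∧ ¬ WindowPositive (Q + c • B) := by
  have key : ∀ v : Fin n → ℝ, v ⬝ᵥ ((-B) *ᵥ v) = -(v ⬝ᵥ (B *ᵥ v)) := by
    intro v
    rw [Matrix.neg_mulVec, dotProduct_neg]
  have hβ' : 0 < u ⬝ᵥ ((-B) *ᵥ u) := by rw [key]; linarith
  have hgap' : ∀ i ∈ S, 0 < t i ⬝ᵥ ((-B) *ᵥ t i) →
      (u ⬝ᵥ (Q *ᵥ u)) * (t i ⬝ᵥ ((-B) *ᵥ t i)) < (t i ⬝ᵥ (Q *ᵥ t i)) * (u ⬝ᵥ ((-B) *ᵥ u)) := by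
    intro i hi hbi
    rw [key] at hbi ⊢
    rw [key]
    have h := hgap i hi (by linarith)
    linarith
  obtain ⟨c, hc0, hP, hneg⟩ := fixedTests_sub_smul_meets_negative S t Q (-B) hacc u hβ' hgap'
  refine ⟨c, hc0, ?_, ?_⟩
  · simpa [smul_neg, sub_neg_eq_add] using hP
  · simpa [smul_neg, sub_neg_eq_add] using hneg

/-- **PROVED (realised in the dial space, up side).**  At a window reaching `p` with `w p ≠ 0`: a
fixed-test criterion accepting `w`'s even block, and a vector `u` with positive `p`-pattern value
beating every positively-patterned test in the pencil ratio, give a `p`-dial of `w` whose block passes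
every test and is not window-positive.  With `w = zetaWeights`, `u = u₁(win)`: every object-independent
test family not containing `ζ`'s extremal up-pencil vector at `win` is unsound there. [folklore] -/
theorem fixedTests_meets_negative {p : ℕ} {win : Window} (hp : p ∈ primeRange (2 * win.a))
    {w : Weights} (hw : w p ≠ 0) {ι : Type*} (S : Finset ι) (t : ι → Fin (win.N + 1) → ℝ)
    (hacc : (∀ i ∈ S, 0 ≤ t i ⬝ᵥ (evenBlock w win *ᵥ t i)))
    (u : Fin (win.N + 1) → ℝ) (hβ : 0 < u ⬝ᵥ (primePattern p win *ᵥ u))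
    (hgap : ∀ i ∈ S, 0 < t i ⬝ᵥ (primePattern p win *ᵥ t i) →
      (u ⬝ᵥ (evenBlock w win *ᵥ u)) * (t i ⬝ᵥ (primePattern p win *ᵥ t i)) <
        (t i ⬝ᵥ (evenBlock w win *ᵥ t i)) * (u ⬝ᵥ (primePattern p win *ᵥ u))) :
    ∃ K : ℝ, (∀ i ∈ S, 0 ≤ t i ⬝ᵥ (evenBlock (dial p K w) win *ᵥ t i)) ∧
      ¬ WindowPositive (evenBlock (dial p K w) win) := by
  obtain ⟨c, -, hP, hneg⟩ :=
    fixedTests_sub_smul_meets_negative S t (evenBlock w win) (primePattern p win) hacc u hβ hgap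
  refine ⟨1 + c / (2 * w p), ?_, ?_⟩
  · rw [evenBlock_dial_coeff hp hw]
    exact hP
  · rw [evenBlock_dial_coeff hp hw]
    exact hneg

/-- **PROVED (realised in the dial space, down side).**  Same with a vector of negative `p`-pattern
value beating every negatively-patterned test: the down-dial `K = 1 − c/(2 w p)` passes every test and
is not window-positive. [folklore] -/
theorem fixedTests_meets_negative_down {p : ℕ} {win : Window} (hp : p ∈ primeRange (2 * win.a))
    {w : Weights} (hw : w p ≠ 0) {ι : Type*} (S : Finset ι) (t : ι → Fin (win.N + 1) → ℝ)
    (hacc : (∀ i ∈ S, 0 ≤ t i ⬝ᵥ (evenBlock w win *ᵥ t i)))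
    (u : Fin (win.N + 1) → ℝ) (hβ : u ⬝ᵥ (primePattern p win *ᵥ u) < 0)
    (hgap : ∀ i ∈ S, t i ⬝ᵥ (primePattern p win *ᵥ t i) < 0 →
      (t i ⬝ᵥ (evenBlock w win *ᵥ t i)) * (u ⬝ᵥ (primePattern p win *ᵥ u)) <
        (u ⬝ᵥ (evenBlock w win *ᵥ u)) * (t i ⬝ᵥ (primePattern p win *ᵥ t i))) :
    ∃ K : ℝ, (∀ i ∈ S, 0 ≤ t i ⬝ᵥ (evenBlock (dial p K w) win *ᵥ t i)) ∧
      ¬ WindowPositive (evenBlock (dial p K w) win) := by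
  obtain ⟨c, -, hP, hneg⟩ :=
    fixedTests_add_smul_meets_negative S t (evenBlock w win) (primePattern p win) hacc u hβ hgap
  refine ⟨1 + (-c) / (2 * w p), ?_, ?_⟩
  · rw [evenBlock_dial_coeff hp hw, neg_smul, sub_neg_eq_add]
    exact hP
  · rw [evenBlock_dial_coeff hp hw, neg_smul, sub_neg_eq_add]
    exact hneg

/-- **PROVED (datum form, `ζ`, up side).**  The fixed-test criterion `{d | (∀ i ∈ S, 0 ≤ t i ⬝ᵥ (d win *ᵥ t i))}`
contains a detectably negative member of the dial space whenever it accepts `ζ` at `win` and some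
vector beats its positively-patterned tests in the `p`-pencil ratio. [folklore] -/
theorem fixedTests_criterion_meets_dialNegatives {p : ℕ} {win : Window}
    (hp : p ∈ primeRange (2 * win.a)) (hw : zetaWeights p ≠ 0)
    {ι : Type*} (S : Finset ι) (t : ι → Fin (win.N + 1) → ℝ)
    (hacc : (∀ i ∈ S, 0 ≤ t i ⬝ᵥ (zetaDatum win *ᵥ t i)))
    (u : Fin (win.N + 1) → ℝ) (hβ : 0 < u ⬝ᵥ (primePattern p win *ᵥ u))
    (hgap : ∀ i ∈ S, 0 < t i ⬝ᵥ (primePattern p win *ᵥ t i) →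
      (u ⬝ᵥ (zetaDatum win *ᵥ u)) * (t i ⬝ᵥ (primePattern p win *ᵥ t i)) <
        (t i ⬝ᵥ (zetaDatum win *ᵥ t i)) * (u ⬝ᵥ (primePattern p win *ᵥ u))) :
    ∃ d ∈ dialSpace, d ∈ {d : Datum | (∀ i ∈ S, 0 ≤ t i ⬝ᵥ (d win *ᵥ t i))} ∧ DetectablyNegative d := by
  obtain ⟨K, hPK, hneg⟩ := fixedTests_meets_negative hp hw S t hacc u hβ hgap
  refine ⟨datumOf (dial p K zetaWeights), ⟨_, rfl⟩, hPK, win, ?_⟩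
  simpa [WindowPositive, datumOf, not_forall, not_le] using hneg

end Summit.RiemannHypothesis.RiemannHypothesis.Theorems.PfPersistence

end
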